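import Literature.Probability.RandomPlanarGeometry.SLERestrictionMartingaleExistsKappa
import Mathlib.Topology.UniformSpace.UniformApproximation
import HarnessLib

/-!
# The tilted [LSW] Theorem 6.5 (line `boundary-area-law`, RS5b): the Prop. 5.3 martingale has continuous paths a.s.

Line `boundary-area-law` of the crux `SubseqIdentification` (stmt-CriticalPhenomena-0783), restriction
reshape (lead c4, r-c4-3), stub RS5b `stub_thm65Tilted`. A small input of step (T2a) of the plan
`RS5b-PLAN.md` (pulling the bounded `𝓕_{τₙ}`-measurable factor `Mⁿ_{τₙ}` out of the increment
`Y_t − Y_{t ∧ τₙ}` by `Process.isAEMartingale_mul_stoppedProcess_sub`, which needs almost surely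
continuous paths of the martingale): **the compensated restriction martingale `Ȳ = YbarK κ α λ hA hne k₀`
of [LSW] Prop. 5.3 (`0 < κ ≤ 8/3`) has almost surely continuous paths** — it is the locally uniform
(indeed uniform) limit of the continuous stopped processes `Y^{T_{k+k₀}}`
(`ae_cauchy_stoppedProcess_YprocK`, `ae_tendsto_locMartK_YbarK`, `martingale_stoppedProcess_YprocK`).

Reference: G. F. Lawler, O. Schramm, W. Werner, *Conformal restriction: the chordal case* (2003),
Prop. 5.3. No named fact is used.
-/

noncomputable section

open MeasureTheory Filter Topology Set
open scoped NNReal ENNReal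
open Literature.Probability.RandomPlanarGeometry
open Literature.Probability.Process (preWienerMeasure)

namespace Summit.CriticalPhenomena.SAWScalingLimit.Theorems.SubseqIdentification.BoundaryAreaLaw

/-- **`Ȳ` has almost surely continuous paths** (`0 < κ ≤ 8/3`, `α = (6−κ)/(2κ)`,
`λ = (8−3κ)(6−κ)/(2κ)`, nonempty `A ∈ 𝒬*`, `k₀` with positive localising times): the stopped
processes `Y^{T_{k+k₀}}` are continuous in `t`, a.s. uniformly Cauchy in `t`, and converge to `Ȳ_t`
at every `t`. [cite: LawlerSchrammWerner2003Restriction, Prop. 5.3] -/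
theorem ae_continuous_YbarK :
    ∀ (κ : ℝ≥0) (α lam : ℝ), 0 < κ → κ ≤ 8 / 3 → α = (6 - κ) / (2 * κ) →
      lam = (8 - 3 * κ) * (6 - κ) / (2 * κ) → ∀ (A : Set ℂ) (hA : IsStarHull A) (hne : A.Nonempty) (k₀ : ℕ),
      (∀ k, k₀ ≤ k → ∀ ω, (0 : WithTop ℝ≥0) < locTimeK κ hA hne k ω) →
      ∀ᵐ ω ∂preWienerMeasure, Continuous fun t ↦ YbarK κ α lam hA hne k₀ t ω := by
  intro κ α lam hκ0 hκ hαdef hlamdef A hA hne k₀ hk₀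
  have hpos : ∀ k ω, (0 : WithTop ℝ≥0) < locTimeK κ hA hne (k + k₀) ω := fun k ω ↦ hk₀ _ le_add_self ω
  set Z : ℕ → ℝ≥0 → (ℝ≥0 → ℝ) → ℝ := fun k ↦ stoppedProcess (YprocK κ α lam A) (locTimeK κ hA hne (k + k₀)) with hZ
  have hZeq : ∀ k, Z k = locMartK κ α lam hA hne (k + k₀) := fun k ↦ stoppedProcess_YprocK_eq_locMartK (hpos k)
  have hZc : ∀ k ω, Continuous fun t ↦ Z k t ω := fun k ↦
    (martingale_stoppedProcess_YprocK hκ0 hκ hαdef hlamdef (hpos k)).2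
  filter_upwards [ae_cauchy_stoppedProcess_YprocK hκ0 hκ hαdef hlamdef hk₀,
    ae_tendsto_locMartK_YbarK hκ0 hκ hαdef hlamdef hk₀] with ω hcauchy hlim
  -- uniform convergence of `Z k · ω` to `Ȳ · ω`
  have hunif : TendstoUniformly (fun k t ↦ Z k t ω) (fun t ↦ YbarK κ α lam hA hne k₀ t ω) atTop := by
    rw [Metric.tendstoUniformly_iff]
    intro ε hε
    obtain ⟨K, hK⟩ := hcauchy (ε / 2) (half_pos hε)
    refine eventually_atTop.2 ⟨K, fun k hk t ↦ ?_⟩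
    have hlimt : Tendsto (fun J ↦ Z J t ω) atTop (𝓝 (YbarK κ α lam hA hne k₀ t ω)) := by
      have := hlim t
      simp_rw [← hZeq] at this
      exact this
    have hle : |YbarK κ α lam hA hne k₀ t ω - Z k t ω| ≤ ε / 2 := by
      have hcont : Tendsto (fun J ↦ |Z J t ω - Z k t ω|) atTop (𝓝 |YbarK κ α lam hA hne k₀ t ω - Z k t ω|) :=
        ((hlimt.sub tendsto_const_nhds).abs)
      exact le_of_tendsto hcont (eventually_atTop.2 ⟨k, fun J hJ ↦ hK k hk J hJ t⟩)
    rw [Real.dist_eq]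
    linarith
  exact hunif.continuous (Frequently.of_forall fun k ↦ hZc k ω)

end Summit.CriticalPhenomena.SAWScalingLimit.Theorems.SubseqIdentification.BoundaryAreaLaw

end
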